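import Literature.NumberTheory.Rogawski1990.U3Readings

/-!
# Consequences of Rogawski's classification for eigensystems: the Hecke character `λ` and the
# holomorphy type at `ι` are determined by the Satake parameters, and transform under `Aut(ℂ)`
# with the CM type — kernel-checked over the dictionary `U3Spectrum`

What the classification of `Literature/NumberTheory/Rogawski1990/{U3Spectrum,U3Readings}.lean`
([DimitrovRamakrishnan2015] Def 3.1 / Thm 3.2, after [Rogawski1990]) delivers BY ITSELF about the
Hecke eigensystems of the cohomological representations of `G = U(V)`, proved from the typed
predicates taken as hypotheses (nothing is asserted; every input is displayed):

* `lval_eq_ae` — two automorphic members of packets `Π(λ,ν)`, `Π(λ',ν')` (pairs in `Ξ`) with the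
  same Satake parameters at almost all places have `λ_w(ϖ_w) = λ'_w(ϖ_w)` at almost all places
  (the elements of absolute value `q_w^{±1/2}` of the Satake multiset determine `λ_w(ϖ_w)`);
* `holomorphy_determined_by_satake` — hence (given rigidity of Hecke characters) they have the same
  holomorphy type at `ι`: if one is `π⁺`, the other is not `π⁻`;
* `cmType_twist_of_satake_twist` / `holomorphic_iff_of_satake_twist` — the Galois-twisted forms:
  if the Satake parameters of `π'` are the `τ`-images (`τ ∈ Aut(ℂ)`) of those of `π` at almost all
  places, then the CM types satisfy `Φ' = τΦ`, and `π'` is holomorphic at `ι` iff `τ⁻¹ ∘ e ∈ Φ` for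
  the fixed embedding `e` of the holomorphy dichotomy.
These are the formal skeleton of the standard argument "the CM type attached to a cohomological
eigensystem of a Picard modular surface is read off the eigensystem and is `Aut(ℂ)`-equivariant".

INPUTS, all displayed as hypotheses: the derived `holomorphyDichotomy` and the reading
`satakeReading` (`U3Readings.lean`); two DEFINITIONAL dictionary constraints named below
(`UnitaryValues`, `OneLtQCard` — unitary characters have unit values on uniformisers; residue
fields have ≥ 2 elements); and two STANDARD INPUTS displayed as hypothesis shapes with no citation
claimed (`HeckeCharRigid` — rigidity of Hecke characters, "strong multiplicity one for `GL(1)`":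
a continuous character of `𝔸_M^×/M^×` trivial on `M_w^×` for all `w` outside a finite set is
trivial, by weak approximation; `AutTwist` — `Aut(ℂ)` acts on the algebraic Hecke characters of
weight `−1` underlying the pairs in `Ξ`, transporting finite parts and infinity types: CM theory
of algebraic Hecke characters, Weil 1955 / Serre, *Abelian ℓ-adic representations* II-2 /
Schappacher, LNM 1301 Ch. 0 — named for their meaning, not cited as inputs of this file).

## References

* M. Dimitrov, D. Ramakrishnan, Doc. Math. 20 (2015), Def 3.1, Thm 3.2 (i)–(ii) and display
  (12), pp. 8–9. [DimitrovRamakrishnan2015]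
* J. Rogawski, Ann. of Math. Stud. 123 (1990), Prop 13.2.2 (d), §13.3. [Rogawski1990]
-/

noncomputable section

open NumberField NumberField.ComplexEmbedding

namespace Literature.NumberTheory.Rogawski1990

open Literature.AlgebraicGeometry.Motives (CMType)
open Literature.NumberTheory.ComplexMultiplication.CMTypeOps

universe u

namespace U3Spectrum

section AutTwistAct

variable {M : Type u} [Field M]

/-- The action of `Aut(ℂ)` on the complex embeddings of `M` by composition (`ρ ↦ τ ∘ ρ`).
[folklore] -/
def autTwistAct (τ : ℂ ≃+* ℂ) (ρ : M →+* ℂ) : M →+* ℂ := τ.toRingHom.comp ρ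

/-- Unfolding of `autTwistAct`. [folklore] -/
@[simp] theorem autTwistAct_apply (τ : ℂ ≃+* ℂ) (ρ : M →+* ℂ) (x : M) :
    autTwistAct τ ρ x = τ (ρ x) := rfl

end AutTwistAct

variable {M : Type u} [Field M] [NumberField M] [IsCMField M] {ι : M →+* ℂ} (S : U3Spectrum M ι)

/-- The Satake multiset of the reading `satakeReading` (the literal inlined there):
`{ν_M,w(ϖ_w), λ_w(ϖ_w) q_w^{1/2}, λ_w(ϖ_w) q_w^{−1/2}}`.
[cite: DimitrovRamakrishnan2015, Theorem 3.2 (i) and display (12), pp. 8–9] -/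
def satMultiset (lam : S.HChar) (nu : S.AChar) (w : S.FinPlace) : Multiset ℂ :=
  {S.nval nu w, S.lval lam w * (Real.sqrt (S.qCard w) : ℂ), S.lval lam w * ((Real.sqrt (S.qCard w) : ℂ)⁻¹)}

/-- Unfolding of `satakeReading` through `satMultiset`.
[cite: DimitrovRamakrishnan2015, Theorem 3.2 (i) and display (12), pp. 8–9] -/
theorem satakeReading_iff :
    S.satakeReading ↔
      ∀ (lam : S.HChar) (nu : S.AChar), S.InXi lam nu → ∀ π ∈ S.packet lam nu, S.m π ≠ 0 →
        {w : S.FinPlace | S.satake π w ≠ S.satMultiset lam nu w}.Finite :=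
  Iff.rfl

/-! ### DEFINITIONAL dictionary constraints and STANDARD INPUT shapes (no citation involved) -/

/-- DEFINITIONAL (dictionary constraint): a unitary character has values of absolute value one on
uniformisers (`λ_w(ϖ_w)`, `ν_M,w(ϖ_w)`). [folklore] -/
def UnitaryValues (S : U3Spectrum M ι) : Prop :=
  (∀ (lam : S.HChar) (w : S.FinPlace), ‖S.lval lam w‖ = 1) ∧
    (∀ (nu : S.AChar) (w : S.FinPlace), ‖S.nval nu w‖ = 1)

/-- DEFINITIONAL (dictionary constraint): residue fields have at least two elements, `1 < q_w`.
[folklore] -/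
def OneLtQCard (S : U3Spectrum M ι) : Prop := ∀ w : S.FinPlace, 1 < S.qCard w

/-- **STD** (hypothesis shape, no citation claimed): rigidity of Hecke characters — if
`λ_w(ϖ_w) = λ'_w(ϖ_w)` for all but finitely many `w`, then `λ = λ'` ("strong multiplicity one for
`GL(1)`": weak approximation + continuity). [folklore] -/
def HeckeCharRigid (S : U3Spectrum M ι) : Prop :=
  ∀ lam lam' : S.HChar, {w : S.FinPlace | S.lval lam w ≠ S.lval lam' w}.Finite → lam = lam'

/-- **STD** (hypothesis shape, no citation claimed): `Aut(ℂ)`-twists of the Hecke characters `λ`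
occurring in pairs `(λ,ν) ∈ Ξ` (algebraic of weight `−1`): for every `τ` and every such `λ` there
is `λ^τ` with (i) `λ^τ_w(ϖ_w) · √q_w = τ (λ_w(ϖ_w) · √q_w)` at every finite place `w`, and
(ii) `expo λ^τ (τ ∘ ρ) = expo λ ρ` for every embedding `ρ` (CM theory of algebraic Hecke characters;
named for its meaning, displayed as a hypothesis). [folklore] -/
def AutTwist (S : U3Spectrum M ι) : Prop :=
  ∀ (τ : ℂ ≃+* ℂ) (lam : S.HChar) (nu : S.AChar), S.InXi lam nu →
    ∃ lamτ : S.HChar,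
      (∀ w : S.FinPlace, S.lval lamτ w * (Real.sqrt (S.qCard w) : ℂ) =
          τ (S.lval lam w * (Real.sqrt (S.qCard w) : ℂ))) ∧
      (∀ ρ : M →+* ℂ, S.expo lamτ (autTwistAct τ ρ) = S.expo lam ρ)

/-! ### Consequences of the classification -/

/-- K.  Def 3.1 read back: the CM type of a pair in `Ξ` is determined by `λ` —
`Φ = {τ : expo λ τ = −1}`. [cite: DimitrovRamakrishnan2015, Definition 3.1, p. 8] -/
theorem mem_iff_expo_eq_neg_one {lam : S.HChar} {nu : S.AChar} {Φ : CMType M}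
    (h : S.IsXiWith lam nu Φ) (τ : M →+* ℂ) : τ ∈ Φ.1 ↔ S.expo lam τ = -1 := by
  constructor
  · intro hτ; exact (h.2.1 τ hτ).1
  · intro hexp
    by_contra hτ
    have hc : conjugate τ ∈ Φ.1 := (conjugate_mem_iff_notMem Φ τ).mpr hτ
    have := (h.2.1 (conjugate τ) hc).2
    rw [show conjugate (conjugate τ) = τ from involutive_conjugate M τ] at this
    omega

/-- K.  For `(λ,ν) ∈ Ξ` the exponent of `λ` at EVERY embedding is `−1` or `+1` (every embedding is
in `Φ` or is the conjugate of one in `Φ`). [cite: DimitrovRamakrishnan2015, Definition 3.1, p. 8] -/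
theorem expo_eq_neg_one_or_one {lam : S.HChar} {nu : S.AChar} {Φ : CMType M}
    (h : S.IsXiWith lam nu Φ) (τ : M →+* ℂ) : S.expo lam τ = -1 ∨ S.expo lam τ = 1 := by
  by_cases hτ : τ ∈ Φ.1
  · exact Or.inl (h.2.1 τ hτ).1
  · right
    have hc : conjugate τ ∈ Φ.1 := (conjugate_mem_iff_notMem Φ τ).mpr hτ
    have := (h.2.1 (conjugate τ) hc).2
    rwa [show conjugate (conjugate τ) = τ from involutive_conjugate M τ] at this

/-- K.  The CM type of a pair in `Ξ` IS the set `{ρ : expo λ ρ = −1}`.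
[cite: DimitrovRamakrishnan2015, Definition 3.1, p. 8] -/
theorem cmType_eq_setOf_expo {lam : S.HChar} {nu : S.AChar} {Φ : CMType M}
    (h : S.IsXiWith lam nu Φ) : Φ.1 = {ρ : M →+* ℂ | S.expo lam ρ = -1} := by
  ext ρ; exact S.mem_iff_expo_eq_neg_one h ρ

/-- K.  Two pairs in `Ξ` with the same `λ` have the same CM type.
[cite: DimitrovRamakrishnan2015, Definition 3.1, p. 8] -/
theorem cmType_eq_of_isXiWith {lam : S.HChar} {nu nu' : S.AChar} {Φ Φ' : CMType M}
    (h : S.IsXiWith lam nu Φ) (h' : S.IsXiWith lam nu' Φ') : Φ = Φ' := by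
  apply Subtype.ext
  ext τ
  rw [S.mem_iff_expo_eq_neg_one h, S.mem_iff_expo_eq_neg_one h']

/-- K.  For a FIXED Hecke character: by the holomorphy dichotomy, if some member of a packet with
character `λ` is `π⁺` at `ι`, then no member of any packet in `Ξ` with the same `λ` is `π⁻` (a CM
type contains exactly one of `e`, `ē`).
[cite: DimitrovRamakrishnan2015, Theorem 3.2 (i)–(ii), pp. 8–9] -/
theorem not_Jminus_of_Jplus (h1 : S.holomorphyDichotomy) {lam : S.HChar} {nu nu' : S.AChar}
    {Φ Φ' : CMType M} (h : S.IsXiWith lam nu Φ) (h' : S.IsXiWith lam nu' Φ')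
    {π π' : S.Rep} (hπ : π ∈ S.packet lam nu) (hπ' : π' ∈ S.packet lam nu')
    (hJ : S.locIota π = S.Jp) : S.locIota π' ≠ S.Jm := by
  obtain ⟨e, -, hrule⟩ := h1
  intro hJ'
  have he : e ∈ Φ.1 := (hrule lam nu Φ h π hπ).1 hJ
  have he' : conjugate e ∈ Φ'.1 := (hrule lam nu' Φ' h' π' hπ').2 hJ'
  have hΦ : Φ = Φ' := S.cmType_eq_of_isXiWith h h'
  rw [hΦ] at he
  exact ((mem_iff_conjugate_notMem Φ' e).mp he) he'

/-- K (extraction).  In `{x, y√q, y/√q}` with `|x| = |y| = 1 < q`, the element of absolute value `√q`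
is `y√q`; hence equal Satake multisets have equal `λ_w(ϖ_w)`. [folklore] -/
theorem lval_eq_of_satMultiset_eq (hU : S.UnitaryValues) (hq : S.OneLtQCard)
    {lam lam' : S.HChar} {nu nu' : S.AChar} {w : S.FinPlace}
    (h : S.satMultiset lam nu w = S.satMultiset lam' nu' w) : S.lval lam w = S.lval lam' w := by
  set r : ℂ := (Real.sqrt (S.qCard w) : ℂ) with hr
  have hq1 : (1 : ℝ) < Real.sqrt (S.qCard w) := by
    rw [show (1:ℝ) = Real.sqrt 1 by simp]
    exact Real.sqrt_lt_sqrt (by norm_num) (by exact_mod_cast hq w)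
  have hrnorm : ‖r‖ = Real.sqrt (S.qCard w) := by
    rw [hr, Complex.norm_real, Real.norm_eq_abs, abs_of_pos (by linarith)]
  have hrpos : (0 : ℝ) < ‖r‖ := by rw [hrnorm]; linarith
  have nx : ∀ nu₀ : S.AChar, ‖S.nval nu₀ w‖ = 1 := fun nu₀ => hU.2 nu₀ w
  have ny : ∀ lam₀ : S.HChar, ‖S.lval lam₀ w * r‖ = Real.sqrt (S.qCard w) := by
    intro lam₀; rw [norm_mul, hU.1 lam₀ w, one_mul, hrnorm]
  have nz : ∀ lam₀ : S.HChar, ‖S.lval lam₀ w * r⁻¹‖ = (Real.sqrt (S.qCard w))⁻¹ := by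
    intro lam₀; rw [norm_mul, hU.1 lam₀ w, one_mul, norm_inv, hrnorm]
  have hmem : S.lval lam w * r ∈ S.satMultiset lam' nu' w := by
    rw [← h]; simp [satMultiset, hr]
  simp only [satMultiset, Multiset.mem_cons, Multiset.mem_singleton, Multiset.insert_eq_cons] at hmem
  rcases hmem with h1 | h2 | h3
  · exfalso
    have := congrArg norm h1
    rw [ny, nx] at this; linarith
  · have hr0 : r ≠ 0 := by
      intro h0; rw [h0, norm_zero] at hrpos; exact lt_irrefl _ hrpos
    exact mul_right_cancel₀ hr0 h2
  · exfalso
    have := congrArg norm h3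
    rw [ny, nz] at this
    have hlt : (Real.sqrt (S.qCard w))⁻¹ < 1 := inv_lt_one_of_one_lt₀ hq1
    linarith

/-- **K — `λ` is read off the eigensystem.**  If `π ∈ Π(λ,ν)` and `π' ∈ Π(λ',ν')` (pairs in `Ξ`,
both automorphic) have the same Satake parameters at almost all finite places of `M`, then
`λ_w(ϖ_w) = λ'_w(ϖ_w)` at almost all places.  Inputs: `satakeReading` + `UnitaryValues` +
`OneLtQCard`. [cite: DimitrovRamakrishnan2015, Theorem 3.2 (i) and display (12), pp. 8–9] -/
theorem lval_eq_ae (hS : S.satakeReading) (hU : S.UnitaryValues) (hq : S.OneLtQCard)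
    {lam lam' : S.HChar} {nu nu' : S.AChar} (hx : S.InXi lam nu) (hx' : S.InXi lam' nu')
    {π π' : S.Rep} (hπ : π ∈ S.packet lam nu) (hπ' : π' ∈ S.packet lam' nu')
    (hm : S.m π ≠ 0) (hm' : S.m π' ≠ 0)
    (hsat : {w : S.FinPlace | S.satake π w ≠ S.satake π' w}.Finite) :
    {w : S.FinPlace | S.lval lam w ≠ S.lval lam' w}.Finite := by
  have h1 := (S.satakeReading_iff.mp hS) lam nu hx π hπ hm
  have h2 := (S.satakeReading_iff.mp hS) lam' nu' hx' π' hπ' hm'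
  refine ((h1.union h2).union hsat).subset ?_
  intro w hw
  simp only [Set.mem_union, Set.mem_setOf_eq]
  by_contra hcon
  push Not at hcon
  obtain ⟨⟨e1, e2⟩, e3⟩ := hcon
  exact hw (S.lval_eq_of_satMultiset_eq hU hq (by rw [← e1, e3, e2]))

/-- **K — the holomorphy type is read off the eigensystem (`τ = 1`).**  Two automorphic members of
packets in `Ξ` with the same Satake parameters almost everywhere have the same holomorphy type at
`ι`: if one is `π⁺` the other is not `π⁻`.  Inputs: `holomorphyDichotomy`, `satakeReading`, the
DEFINITIONAL `UnitaryValues`, `OneLtQCard`, the STD shape `HeckeCharRigid`.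
[cite: DimitrovRamakrishnan2015, Theorem 3.2 (i)–(ii) and display (12), pp. 8–9] -/
theorem holomorphy_determined_by_satake (h1 : S.holomorphyDichotomy) (hS : S.satakeReading)
    (hU : S.UnitaryValues) (hq : S.OneLtQCard) (hR : S.HeckeCharRigid)
    {lam lam' : S.HChar} {nu nu' : S.AChar} (hx : S.InXi lam nu) (hx' : S.InXi lam' nu')
    {π π' : S.Rep} (hπ : π ∈ S.packet lam nu) (hπ' : π' ∈ S.packet lam' nu')
    (hm : S.m π ≠ 0) (hm' : S.m π' ≠ 0)
    (hsat : {w : S.FinPlace | S.satake π w ≠ S.satake π' w}.Finite)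
    (hJ : S.locIota π = S.Jp) : S.locIota π' ≠ S.Jm := by
  have hlam : lam = lam' := hR lam lam' (S.lval_eq_ae hS hU hq hx hx' hπ hπ' hm hm' hsat)
  subst hlam
  obtain ⟨Φ, hΦ⟩ := hx
  obtain ⟨Φ', hΦ'⟩ := hx'
  exact S.not_Jminus_of_Jplus h1 hΦ hΦ' hπ hπ' hJ

/-- K.  The same with the roles of `π⁺`/`π⁻` exchanged.
[cite: DimitrovRamakrishnan2015, Theorem 3.2 (i)–(ii) and display (12), pp. 8–9] -/
theorem not_Jplus_of_Jminus_satake (h1 : S.holomorphyDichotomy) (hS : S.satakeReading)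
    (hU : S.UnitaryValues) (hq : S.OneLtQCard) (hR : S.HeckeCharRigid)
    {lam lam' : S.HChar} {nu nu' : S.AChar} (hx : S.InXi lam nu) (hx' : S.InXi lam' nu')
    {π π' : S.Rep} (hπ : π ∈ S.packet lam nu) (hπ' : π' ∈ S.packet lam' nu')
    (hm : S.m π ≠ 0) (hm' : S.m π' ≠ 0)
    (hsat : {w : S.FinPlace | S.satake π w ≠ S.satake π' w}.Finite)
    (hJ : S.locIota π' = S.Jm) : S.locIota π ≠ S.Jp :=
  fun hJ' => S.holomorphy_determined_by_satake h1 hS hU hq hR hx hx' hπ hπ' hm hm' hsat hJ' hJ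

/-! ### The Galois-twisted form (`τ ∈ Aut(ℂ)`) -/

/-- K (ratio extraction).  If `τ ∈ Aut(ℂ)` maps the Satake multiset of `(λ,ν)` at `w` onto that of
`(λ',ν')`, then `τ(λ_w(ϖ)√q) = λ'_w(ϖ)√q` (the only ordered pair of members with ratio `q_w` is
`(y√q, y/√q)`). [folklore] -/
theorem twist_lval_of_satMultiset_map (hU : S.UnitaryValues) (hq : S.OneLtQCard) (τ : ℂ ≃+* ℂ)
    {lam lam' : S.HChar} {nu nu' : S.AChar} {w : S.FinPlace}
    (h : (S.satMultiset lam nu w).map τ = S.satMultiset lam' nu' w) :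
    τ (S.lval lam w * (Real.sqrt (S.qCard w) : ℂ)) = S.lval lam' w * (Real.sqrt (S.qCard w) : ℂ) := by
  obtain ⟨r, hr⟩ : ∃ r : ℂ, (Real.sqrt (S.qCard w) : ℂ) = r := ⟨_, rfl⟩
  obtain ⟨s, hs⟩ : ∃ s : ℝ, Real.sqrt (S.qCard w) = s := ⟨_, rfl⟩
  have hs1 : 1 < s := by
    rw [← hs, show (1:ℝ) = Real.sqrt 1 by simp]
    exact Real.sqrt_lt_sqrt (by norm_num) (by exact_mod_cast hq w)
  have hs0 : 0 < s := by linarith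
  have hs2 : 1 < s * s := by nlinarith
  have hs3 : 1 < s * s * s := by nlinarith
  have hrs : r = (s : ℂ) := by rw [← hr, hs]
  have hrnorm : ‖r‖ = s := by rw [hrs, Complex.norm_real, Real.norm_eq_abs, abs_of_pos hs0]
  have hr0 : r ≠ 0 := by intro h0; rw [h0, norm_zero] at hrnorm; linarith
  have hss : s * s = (S.qCard w : ℝ) := by rw [← hs, Real.mul_self_sqrt (Nat.cast_nonneg _)]
  have hrr : r * r = (S.qCard w : ℂ) := by rw [hrs]; exact_mod_cast hss
  have hτq : τ (S.qCard w : ℂ) = (S.qCard w : ℂ) := map_natCast τ _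
  simp only [satMultiset, hr, Multiset.insert_eq_cons, Multiset.map_cons, Multiset.map_singleton] at h ⊢
  -- the two relevant members of the source multiset, mapped by τ, lie in the target multiset
  have hmem1 : τ (S.lval lam w * r) ∈
      (S.nval nu' w ::ₘ S.lval lam' w * r ::ₘ ({S.lval lam' w * r⁻¹} : Multiset ℂ)) := by
    rw [← h]; simp
  have hmem2 : τ (S.lval lam w * r⁻¹) ∈
      (S.nval nu' w ::ₘ S.lval lam' w * r ::ₘ ({S.lval lam' w * r⁻¹} : Multiset ℂ)) := by
    rw [← h]; simp
  -- τ(l r) = τ(l r⁻¹) · q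
  have hrel : τ (S.lval lam w * r) = τ (S.lval lam w * r⁻¹) * (S.qCard w : ℂ) := by
    rw [← hτq, ← map_mul]; congr 1
    rw [← hrr]; field_simp
  -- norms in the target multiset
  have nx : ‖S.nval nu' w‖ = 1 := hU.2 nu' w
  have ny : ‖S.lval lam' w * r‖ = s := by rw [norm_mul, hU.1 lam' w, one_mul, hrnorm]
  have nz : ‖S.lval lam' w * r⁻¹‖ = s⁻¹ := by rw [norm_mul, hU.1 lam' w, one_mul, norm_inv, hrnorm]
  have hqn : ‖(S.qCard w : ℂ)‖ = s * s := by rw [Complex.norm_natCast, hss]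
  have hnrel : ‖τ (S.lval lam w * r)‖ = ‖τ (S.lval lam w * r⁻¹)‖ * (s * s) := by
    rw [hrel, norm_mul, hqn]
  simp only [Multiset.mem_cons, Multiset.mem_singleton] at hmem1 hmem2
  have hsinv : s⁻¹ * s = 1 := inv_mul_cancel₀ (ne_of_gt hs0)
  rcases hmem1 with a1 | a1 | a1
  · exfalso
    have e1 := congrArg norm a1; rw [hnrel, nx] at e1
    rcases hmem2 with b1 | b1 | b1
    · rw [b1, nx] at e1; nlinarith
    · rw [b1, ny] at e1; nlinarith
    · rw [b1, nz] at e1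
      have : s⁻¹ * (s * s) = s := by rw [← mul_assoc, hsinv, one_mul]
      rw [this] at e1; linarith
  · exact a1
  · exfalso
    have e1 := congrArg norm a1; rw [hnrel, nz] at e1
    rcases hmem2 with b1 | b1 | b1
    · rw [b1, nx] at e1
      have : s⁻¹ < 1 := inv_lt_one_of_one_lt₀ hs1
      nlinarith
    · rw [b1, ny] at e1
      have : s⁻¹ < 1 := inv_lt_one_of_one_lt₀ hs1
      nlinarith
    · rw [b1, nz] at e1
      have : s⁻¹ * (s * s) = s := by rw [← mul_assoc, hsinv, one_mul]
      rw [this] at e1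
      have : s⁻¹ < 1 := inv_lt_one_of_one_lt₀ hs1
      linarith

/-- **K — conjugation of the CM type, general `τ ∈ Aut(ℂ)`.**  Let `π ∈ Π(λ,ν)`, `π' ∈ Π(λ',ν')` be
automorphic, `(λ,ν), (λ',ν') ∈ Ξ` with CM types `Φ`, `Φ'`, and suppose the Satake parameters of
`π'` are the `τ`-images of those of `π` at almost all places (displayed hypothesis `hconj`).  Then
`Φ' = τΦ`: `τ ∘ ρ ∈ Φ' ↔ ρ ∈ Φ`.  Inputs: `satakeReading` (U), `UnitaryValues`, `OneLtQCard`
(DEFINITIONAL), `HeckeCharRigid`, `AutTwist` (STD shapes).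
[cite: DimitrovRamakrishnan2015, Definition 3.1, Theorem 3.2 (i) and display (12), pp. 8–9] -/
theorem cmType_twist_of_satake_twist (hS : S.satakeReading) (hU : S.UnitaryValues)
    (hq : S.OneLtQCard) (hR : S.HeckeCharRigid) (hT : S.AutTwist) (τ : ℂ ≃+* ℂ)
    {lam lam' : S.HChar} {nu nu' : S.AChar} {Φ Φ' : CMType M}
    (hx : S.IsXiWith lam nu Φ) (hx' : S.IsXiWith lam' nu' Φ')
    {π π' : S.Rep} (hπ : π ∈ S.packet lam nu) (hπ' : π' ∈ S.packet lam' nu')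
    (hm : S.m π ≠ 0) (hm' : S.m π' ≠ 0)
    (hconj : {w : S.FinPlace | S.satake π' w ≠ (S.satake π w).map τ}.Finite) (ρ : M →+* ℂ) :
    τ.toRingHom.comp ρ ∈ Φ'.1 ↔ ρ ∈ Φ.1 := by
  obtain ⟨lamτ, hval, hexp⟩ := hT τ lam nu ⟨Φ, hx⟩
  have hexp' : ∀ ρ' : M →+* ℂ, S.expo lamτ (τ.toRingHom.comp ρ') = S.expo lam ρ' := hexp
  -- λ' agrees with λ^τ at almost all places
  have h1 := (S.satakeReading_iff.mp hS) lam nu ⟨Φ, hx⟩ π hπ hm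
  have h2 := (S.satakeReading_iff.mp hS) lam' nu' ⟨Φ', hx'⟩ π' hπ' hm'
  have hfin : {w : S.FinPlace | S.lval lamτ w ≠ S.lval lam' w}.Finite := by
    refine ((h1.union h2).union hconj).subset ?_
    intro w hw
    simp only [Set.mem_union, Set.mem_setOf_eq]
    by_contra hcon
    push Not at hcon
    obtain ⟨⟨e1, e2⟩, e3⟩ := hcon
    have hmap : (S.satMultiset lam nu w).map τ = S.satMultiset lam' nu' w := by rw [← e1, ← e3, e2]
    have ht := S.twist_lval_of_satMultiset_map hU hq τ hmap
    have hr0 : (Real.sqrt (S.qCard w) : ℂ) ≠ 0 := by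
      have : (0 : ℝ) < Real.sqrt (S.qCard w) :=
        Real.sqrt_pos.mpr (by exact_mod_cast Nat.lt_of_lt_of_le Nat.zero_lt_one (hq w).le)
      exact_mod_cast this.ne'
    exact hw (mul_right_cancel₀ hr0 ((hval w).trans ht))
  have hlam : lamτ = lam' := hR lamτ lam' hfin
  subst hlam
  rw [S.mem_iff_expo_eq_neg_one hx' (τ.toRingHom.comp ρ), S.mem_iff_expo_eq_neg_one hx ρ, hexp' ρ]

/-- **K — the holomorphy criterion under `Aut(ℂ)`-twist.**  In the situation of
`cmType_twist_of_satake_twist`, if moreover `π'_ι ≅ π^±` then `π'` is holomorphic (`π'_ι ≅ π⁺`) iff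
`τ⁻¹ ∘ e ∈ Φ`, where `e ∈ {ι, ῑ}` is the fixed embedding of the holomorphy dichotomy.  Inputs:
`holomorphyDichotomy` plus those of `cmType_twist_of_satake_twist`.
[cite: DimitrovRamakrishnan2015, Definition 3.1, Theorem 3.2 (i)–(ii) and display (12), pp. 8–9] -/
theorem holomorphic_iff_of_satake_twist (hD : S.holomorphyDichotomy) (hS : S.satakeReading)
    (hU : S.UnitaryValues) (hq : S.OneLtQCard) (hR : S.HeckeCharRigid) (hT : S.AutTwist)
    (τ : ℂ ≃+* ℂ) {lam lam' : S.HChar} {nu nu' : S.AChar} {Φ Φ' : CMType M}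
    (hx : S.IsXiWith lam nu Φ) (hx' : S.IsXiWith lam' nu' Φ')
    {π π' : S.Rep} (hπ : π ∈ S.packet lam nu) (hπ' : π' ∈ S.packet lam' nu')
    (hm : S.m π ≠ 0) (hm' : S.m π' ≠ 0)
    (hconj : {w : S.FinPlace | S.satake π' w ≠ (S.satake π w).map τ}.Finite)
    (hJ' : S.IsJpmAtIota π') :
    ∃ e : M →+* ℂ, e ∈ placeSet ι ∧
      (∀ (l : S.HChar) (n : S.AChar) (Ψ : CMType M), S.IsXiWith l n Ψ → ∀ p ∈ S.packet l n,
          (S.locIota p = S.Jp → e ∈ Ψ.1) ∧ (S.locIota p = S.Jm → conjugate e ∈ Ψ.1)) ∧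
      (S.locIota π' = S.Jp ↔ τ.symm.toRingHom.comp e ∈ Φ.1) := by
  obtain ⟨e, he, hrule⟩ := hD
  refine ⟨e, he, hrule, ?_⟩
  have key : τ.toRingHom.comp (τ.symm.toRingHom.comp e) = e := by
    ext x; simp
  have hΦ' : e ∈ Φ'.1 ↔ τ.symm.toRingHom.comp e ∈ Φ.1 := by
    have := S.cmType_twist_of_satake_twist hS hU hq hR hT τ hx hx' hπ hπ' hm hm' hconj
      (τ.symm.toRingHom.comp e)
    rw [key] at this
    exact this
  rw [← hΦ']
  constructor
  · intro hp; exact (hrule lam' nu' Φ' hx' π' hπ').1 hp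
  · intro heΦ'
    rcases hJ' with hp | hm2
    · exact hp
    · exfalso
      have := (hrule lam' nu' Φ' hx' π' hπ').2 hm2
      exact ((mem_iff_conjugate_notMem Φ' e).mp heΦ') this

end U3Spectrum

end Literature.NumberTheory.Rogawski1990

end
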